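import Summits.Langlands.Langlands.Theorems.ParityBlindBianchiArtinWeightRealisationEvenStubTwistConjugateNormalForm
import HarnessLib

/-!
# Stub `stub_twistConjugateOfSignedTraces` (S4b) of the line `SketchIdeator2` for the crux
# `ParityBlindBianchi.ArtinWeightRealisationEven` (item stmt-Langlands-16619) — part 3/3:
# the dihedral normal form and the stub

Pure algebra — the core of the pinning lemma `QuadraticTwistPinning` of the card
`adjoint-unitary-host-sign-pinning`.  Let `Γ` be a group, `A` an algebraically closed field of
characteristic `0`, `σ r : Γ → GL₂(A)` with `σ(Γ)` finite and of projective image `A₅`,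
`det r = det σ` and `tr r = ± tr σ` pointwise, and `r(g)` central whenever `σ(g)` is (stub S4a).
Then `r = χ · M σ M⁻¹` for a character `χ` with `χ² = 1` and some `M ∈ GL₂(A)`.

ELEMENTARY PROOF (no character theory).  (E3, this file) `A₅ ⊇ D₅` gives `g₅, s ∈ Γ` with `σ(g₅)`
of projective order `5` inverted by `σ(s)` projectively (`exists_dihedral_pair`, with
`c = (0 1 2 3 4)`, `t = (1 4)(2 3)`); `σ(g₅)` has eigenvalues `l₁ ≠ l₂` with `l₁⁵ = l₂⁵`, so
`l₁² ≠ l₂²` (`exists_eigenvalues`); conjugating, `σ(g₅) = diag(l₁, l₂)` and `σ(s) = b W`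
(`exists_normal_frame`, applied to `σ` and — with eigenvalues `ε₁ l₁, ε₁ l₂` — to `r`), and
`det r(s) = det σ(s)` fixes `r(s) = ± b W`.  (E4–E5, part 2/3) the normal form forces
`r = χ · M σ M⁻¹`; conjugating back gives the stub.
-/

-- the line's namespace `Summit.Langlands.Langlands.…` (summit = problem = `Langlands`) repeats a
-- component by design
set_option linter.dupNamespace false

namespace Summit.Langlands.Langlands.Theorems.ArtinWeightRealisationEven

open scoped MatrixGroups Matrix
open Literature.NumberTheory.EllipticCurves.DeuringLadic (Matrix.sq_eq_trace_smul_sub_det_fin_two)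
open Literature.NumberTheory.EllipticCurves.Hida2000Thm326 (one_add_pow_of_mul_self_eq_zero)

universe u v

namespace TwistConjugate

variable {A : Type*} [Field A]

/-! ### E3: the dihedral normal form -/

section Frame

variable {Γ : Type u} [Group Γ]

/-- **The dihedral pair.**  If the projective image of `σ` is `A₅`, there are `g₅, s ∈ Γ` with
`σ(g₅)` of projective order `5` (so `σ(g₅⁵)` central, `σ(g₅)` not central) and
`σ(s g₅ s⁻¹ g₅)` central (the relation `t c t⁻¹ = c⁻¹` of `D₅ ⊂ A₅`, `c = (0 1 2 3 4)`,
`t = (1 4)(2 3)`). -/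
theorem exists_dihedral_pair (σ : Γ →* GL (Fin 2) A)
    (e : (Matrix.ProjGenLinGroup.mk.comp σ).range ≃* alternatingGroup (Fin 5)) :
    ∃ g₅ s : Γ, σ (g₅ ^ 5) ∈ Subgroup.center (GL (Fin 2) A) ∧
      σ g₅ ∉ Subgroup.center (GL (Fin 2) A) ∧
      σ (s * g₅ * s⁻¹ * g₅) ∈ Subgroup.center (GL (Fin 2) A) := by
  obtain ⟨gA, tA, hg5, hg1, hrel⟩ : ∃ gA tA : alternatingGroup (Fin 5),
      gA ^ 5 = 1 ∧ gA ≠ 1 ∧ tA * gA * tA⁻¹ * gA = 1 := by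
    refine ⟨⟨finRotate 5, Equiv.Perm.mem_alternatingGroup.mpr ?_⟩,
      ⟨Equiv.swap 1 4 * Equiv.swap 2 3, Equiv.Perm.mem_alternatingGroup.mpr ?_⟩, ?_, ?_, ?_⟩
    · simp [sign_finRotate]
      decide
    · rw [map_mul, Equiv.Perm.sign_swap (by decide), Equiv.Perm.sign_swap (by decide)]
      decide
    · exact Subtype.ext (by decide)
    · exact fun h => absurd (congrArg Subtype.val h) (by decide)
    · exact Subtype.ext (by decide)
  set φ : Γ →* PGL(Fin 2, A) := Matrix.ProjGenLinGroup.mk.comp σ with hφ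
  obtain ⟨g₅, hg₅⟩ : ∃ g : Γ, φ g = ((e.symm gA : φ.range) : PGL(Fin 2, A)) :=
    MonoidHom.mem_range.mp (e.symm gA).2
  obtain ⟨s, hs⟩ : ∃ g : Γ, φ g = ((e.symm tA : φ.range) : PGL(Fin 2, A)) :=
    MonoidHom.mem_range.mp (e.symm tA).2
  have hφ5 : φ (g₅ ^ 5) = 1 := by
    have h1 : e.symm (gA ^ 5) = 1 := by rw [hg5, map_one]
    have h2 := congrArg (fun z : φ.range => (z : PGL(Fin 2, A))) h1
    simp only [map_pow, Subgroup.coe_pow, Subgroup.coe_one] at h2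
    rw [map_pow, hg₅]
    exact h2
  have hφ1 : φ g₅ ≠ 1 := by
    intro h
    apply hg1
    apply e.symm.injective
    rw [map_one]
    ext : 1
    rw [← hg₅, h, Subgroup.coe_one]
  have hφrel : φ (s * g₅ * s⁻¹ * g₅) = 1 := by
    have h1 : e.symm (tA * gA * tA⁻¹ * gA) = 1 := by rw [hrel, map_one]
    have h2 := congrArg (fun z : φ.range => (z : PGL(Fin 2, A))) h1
    simp only [map_mul, map_inv, Subgroup.coe_mul, Subgroup.coe_inv, Subgroup.coe_one] at h2
    simp only [map_mul, map_inv, hg₅, hs]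
    exact h2
  refine ⟨g₅, s, ?_, ?_, ?_⟩
  · rw [← Matrix.ProjGenLinGroup.mk_eq_one]; exact hφ5
  · rw [← Matrix.ProjGenLinGroup.mk_eq_one]; exact hφ1
  · rw [← Matrix.ProjGenLinGroup.mk_eq_one]; exact hφrel

/-- **The eigenvalues of `σ(g₅)`.**  A non-scalar `2 × 2` matrix `S` of finite order whose fifth
power is scalar, over an algebraically closed field of characteristic `0`, has two eigenvalues
`l₁, l₂` (`tr S = l₁ + l₂`, `det S = l₁ l₂`) with `l₁, l₂ ≠ 0`, `l₁ ≠ l₂`, `l₁² ≠ l₂²`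
(indeed `l₂ / l₁` is a primitive fifth root of unity). -/
theorem exists_eigenvalues [IsAlgClosed A] [CharZero A] {S : Matrix (Fin 2) (Fin 2) A} {m : ℕ}
    (hm : 0 < m) (hSm : S ^ m = 1) (hS : ∀ cc : A, S ≠ cc • 1) {c₅ : A} (hS5 : S ^ 5 = c₅ • 1) :
    ∃ l₁ l₂ : A, S.trace = l₁ + l₂ ∧ S.det = l₁ * l₂ ∧ l₁ ≠ 0 ∧ l₂ ≠ 0 ∧ l₁ ≠ l₂ ∧
      l₁ ^ 2 ≠ l₂ ^ 2 := by
  have hdetS : S.det ≠ 0 := by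
    intro h0
    have h := congrArg Matrix.det hSm
    rw [Matrix.det_pow, h0, Matrix.det_one, zero_pow hm.ne'] at h
    exact zero_ne_one h
  obtain ⟨d, hd⟩ := IsAlgClosed.exists_eq_mul_self (S.trace ^ 2 - 4 * S.det)
  obtain ⟨l₁, hl₁⟩ : ∃ l : A, l = (S.trace + d) / 2 := ⟨_, rfl⟩
  obtain ⟨l₂, hl₂⟩ : ∃ l : A, l = (S.trace - d) / 2 := ⟨_, rfl⟩
  have htr : S.trace = l₁ + l₂ := by rw [hl₁, hl₂]; ring
  have hdet : S.det = l₁ * l₂ := by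
    rw [hl₁, hl₂]
    have h4 : (4 : A) ≠ 0 := by norm_num
    field_simp
    linear_combination -hd
  have hl12 : l₁ * l₂ ≠ 0 := hdet ▸ hdetS
  have h1 : l₁ ≠ 0 := left_ne_zero_of_mul hl12
  have h2 : l₂ ≠ 0 := right_ne_zero_of_mul hl12
  have hne : l₁ ≠ l₂ := by
    intro heq
    apply hS l₁
    apply eq_smul_one_of_sq_eq_zero_of_pow_eq_one h1 _ hm hSm
    have hCH := Matrix.sq_eq_trace_smul_sub_det_fin_two S
    rw [htr, hdet, ← heq] at hCH
    have e1 : (S - l₁ • 1) * (S - l₁ • 1) = S * S - l₁ • S - l₁ • S + (l₁ * l₁) • 1 := by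
      simp only [sub_mul, mul_sub, Matrix.smul_mul, Matrix.mul_smul, smul_smul, Matrix.mul_one,
        Matrix.one_mul]
      abel
    rw [e1, hCH]
    module
  obtain ⟨P, hP⟩ := exists_mul_eq_mul_diagonal hne htr hdet
  have hD := inv_mul_mul_eq_of_mul_eq_mul hP
  have hl5 : l₁ ^ 5 = l₂ ^ 5 := by
    have h := conj_pow P S 5
    rw [hD, diag_pow, hS5, Matrix.mul_smul, Matrix.mul_one, Matrix.smul_mul, ← Units.val_mul,
      inv_mul_cancel, Units.val_one] at h
    have e0 := congr_fun (congr_fun h 0) 0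
    have e1 := congr_fun (congr_fun h 1) 1
    simp at e0 e1
    rw [e0, e1]
  have hsq : l₁ ^ 2 ≠ l₂ ^ 2 := by
    intro h
    apply hne
    have h4 : l₁ ^ 4 = l₂ ^ 4 := by
      rw [show (4 : ℕ) = 2 * 2 from rfl, pow_mul, h, ← pow_mul]
    have : l₂ ^ 4 * l₁ = l₂ ^ 4 * l₂ := by
      calc l₂ ^ 4 * l₁ = l₁ ^ 4 * l₁ := by rw [h4]
        _ = l₁ ^ 5 := by ring
        _ = l₂ ^ 5 := hl5
        _ = l₂ ^ 4 * l₂ := by ring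
    exact mul_left_cancel₀ (pow_ne_zero 4 h2) this
  exact ⟨l₁, l₂, htr, hdet, h1, h2, hne, hsq⟩

/-- **The normal frame.**  If `ρ(g₅)` has distinct eigenvalues `l₁, l₂` (non-zero, `l₁² ≠ l₂²`) and
`ρ(g₅) ρ(s) ρ(g₅) = c ρ(s)`, then in a suitable frame `U`, `ρ(g₅) = diag(l₁, l₂)` and
`ρ(s) = b W` with `b ≠ 0` (diagonalise, observe that `ρ(s)` becomes antidiagonal, rescale by
`diag(1, t)` with `t² = y / x`). -/
theorem exists_normal_frame [IsAlgClosed A] (ρ : Γ →* GL (Fin 2) A) {g₅ s : Γ} {l₁ l₂ c : A}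
    (h1 : l₁ ≠ 0) (h2 : l₂ ≠ 0) (hne : l₁ ≠ l₂) (hsq : l₁ ^ 2 ≠ l₂ ^ 2)
    (htr : ((ρ g₅ : GL (Fin 2) A) : Matrix (Fin 2) (Fin 2) A).trace = l₁ + l₂)
    (hdet : ((ρ g₅ : GL (Fin 2) A) : Matrix (Fin 2) (Fin 2) A).det = l₁ * l₂)
    (hrel : ((ρ g₅ : GL (Fin 2) A) : Matrix (Fin 2) (Fin 2) A) * (ρ s : GL (Fin 2) A) *
      (ρ g₅ : GL (Fin 2) A) = c • ((ρ s : GL (Fin 2) A) : Matrix (Fin 2) (Fin 2) A)) :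
    ∃ (U : GL (Fin 2) A) (b : A), b ≠ 0 ∧
      ((U * ρ g₅ * U⁻¹ : GL (Fin 2) A) : Matrix (Fin 2) (Fin 2) A) = !![l₁, 0; 0, l₂] ∧
      ((U * ρ s * U⁻¹ : GL (Fin 2) A) : Matrix (Fin 2) (Fin 2) A) = !![0, b; b, 0] := by
  obtain ⟨P, hP⟩ := exists_mul_eq_mul_diagonal hne htr hdet
  have hD := inv_mul_mul_eq_of_mul_eq_mul hP
  obtain ⟨Xs, hXs⟩ : ∃ X : Matrix (Fin 2) (Fin 2) A,
      ((P⁻¹ : GL (Fin 2) A) : Matrix (Fin 2) (Fin 2) A) * (ρ s : GL (Fin 2) A) * P = X := ⟨_, rfl⟩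
  have hXrel : !![l₁, 0; 0, l₂] * Xs * !![l₁, 0; 0, l₂] = c • Xs := by
    rw [← hD, ← hXs, TwistConjugate.conj_mul, TwistConjugate.conj_mul, hrel, Matrix.mul_smul,
      Matrix.smul_mul]
  have hdetXs : Xs.det ≠ 0 := by
    rw [← hXs, Matrix.det_units_conj']
    exact ((Matrix.isUnit_iff_isUnit_det _).mp (ρ s).isUnit).ne_zero
  obtain ⟨hX00, hX11⟩ := antidiag_of_diag_mul_mul_diag hXrel hdetXs h1 h2 hne hsq
  have hx : Xs 0 1 ≠ 0 ∧ Xs 1 0 ≠ 0 := by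
    rw [Matrix.det_fin_two, hX00, hX11, zero_mul, zero_sub, neg_ne_zero] at hdetXs
    exact ⟨left_ne_zero_of_mul hdetXs, right_ne_zero_of_mul hdetXs⟩
  obtain ⟨t, ht, hxt⟩ := exists_rescale hx.1 hx.2
  have hTdet : (!![(1 : A), 0; 0, t] : Matrix (Fin 2) (Fin 2) A).det ≠ 0 := by
    simp [Matrix.det_fin_two_of, ht]
  obtain ⟨T, hTval⟩ : ∃ T : GL (Fin 2) A, (T : Matrix (Fin 2) (Fin 2) A) = !![(1 : A), 0; 0, t] :=
    ⟨Matrix.GeneralLinearGroup.mkOfDetNeZero _ hTdet, rfl⟩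
  have hTinv : ((T⁻¹ : GL (Fin 2) A) : Matrix (Fin 2) (Fin 2) A) = !![(1 : A), 0; 0, t⁻¹] := by
    rw [Matrix.coe_units_inv, hTval]
    exact Matrix.inv_eq_left_inv (diag_one_inv_mul ht)
  obtain ⟨b, hbdef⟩ : ∃ b : A, Xs 0 1 * t = b := ⟨_, rfl⟩
  have hb : b ≠ 0 := hbdef ▸ mul_ne_zero hx.1 ht
  refine ⟨(P * T)⁻¹, b, hb, ?_, ?_⟩
  · have e1 : (((P * T)⁻¹ * ρ g₅ * (P * T)⁻¹⁻¹ : GL (Fin 2) A) : Matrix (Fin 2) (Fin 2) A) =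
        ((T⁻¹ : GL (Fin 2) A) : Matrix (Fin 2) (Fin 2) A) *
          (((P⁻¹ : GL (Fin 2) A) : Matrix (Fin 2) (Fin 2) A) * (ρ g₅ : GL (Fin 2) A) * P) * T := by
      simp only [mul_inv_rev, inv_inv, Units.val_mul, Matrix.mul_assoc]
    rw [e1, hD, hTinv, hTval, diag_one_conj ht]
    ext i j
    fin_cases i <;> fin_cases j <;> simp
  · have e1 : (((P * T)⁻¹ * ρ s * (P * T)⁻¹⁻¹ : GL (Fin 2) A) : Matrix (Fin 2) (Fin 2) A) =
        ((T⁻¹ : GL (Fin 2) A) : Matrix (Fin 2) (Fin 2) A) *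
          (((P⁻¹ : GL (Fin 2) A) : Matrix (Fin 2) (Fin 2) A) * (ρ s : GL (Fin 2) A) * P) * T := by
      simp only [mul_inv_rev, inv_inv, Units.val_mul, Matrix.mul_assoc]
    rw [e1, hXs, hTinv, hTval, diag_one_conj ht, hX00, hX11, ← hxt, hbdef]

end Frame

end TwistConjugate

open TwistConjugate in
/-- S4b (algebra, the pinning core): under the hypotheses of S4a and its conclusion, `r` is a
quadratic twist of a conjugate of `σ`: `r(g) = χ(g) · M σ(g) M⁻¹` with `χ² = 1`. -/
theorem stub_twistConjugateOfSignedTraces :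
    ∀ (Γ : Type u) [Group Γ] (A : Type v) [Field A] [IsAlgClosed A] [CharZero A]
      (σ r : Γ →* GL (Fin 2) A), Finite σ.range →
      Nonempty ((Matrix.ProjGenLinGroup.mk.comp σ).range ≃* alternatingGroup (Fin 5)) →
      (∀ g : Γ, Matrix.det ((r g : GL (Fin 2) A) : Matrix (Fin 2) (Fin 2) A) =
          Matrix.det ((σ g : GL (Fin 2) A) : Matrix (Fin 2) (Fin 2) A) ∧
        (Matrix.trace ((r g : GL (Fin 2) A) : Matrix (Fin 2) (Fin 2) A) =
            Matrix.trace ((σ g : GL (Fin 2) A) : Matrix (Fin 2) (Fin 2) A) ∨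
         Matrix.trace ((r g : GL (Fin 2) A) : Matrix (Fin 2) (Fin 2) A) =
            -Matrix.trace ((σ g : GL (Fin 2) A) : Matrix (Fin 2) (Fin 2) A))) →
      (∀ g : Γ, σ g ∈ Subgroup.center (GL (Fin 2) A) → r g ∈ Subgroup.center (GL (Fin 2) A)) →
      ∃ (χ : Γ →* Aˣ) (M : GL (Fin 2) A), (∀ g, χ g ^ 2 = 1) ∧
        ∀ g : Γ, ((r g : GL (Fin 2) A) : Matrix (Fin 2) (Fin 2) A) =
          ((χ g : Aˣ) : A) • ((M * σ g * M⁻¹ : GL (Fin 2) A) : Matrix (Fin 2) (Fin 2) A) := by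
  intro Γ _ A _ _ _ σ r hfin hA5 hdt hcen
  haveI := hfin
  obtain ⟨e⟩ := hA5
  /- (1) the dihedral pair -/
  obtain ⟨g₅, s, hcen5, hncen, hcenrel⟩ := exists_dihedral_pair σ e
  have hcen5r : r (g₅ ^ 5) ∈ Subgroup.center (GL (Fin 2) A) := hcen _ hcen5
  have hcenrelr : r (s * g₅ * s⁻¹ * g₅) ∈ Subgroup.center (GL (Fin 2) A) := hcen _ hcenrel
  /- (2) scalars and relations -/
  obtain ⟨c₅, hc₅⟩ := exists_smul_one_of_mem_center hcen5
  obtain ⟨cr, hcr⟩ := exists_smul_one_of_mem_center hcenrel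
  obtain ⟨c₅', hc₅'⟩ := exists_smul_one_of_mem_center hcen5r
  obtain ⟨cr', hcr'⟩ := exists_smul_one_of_mem_center hcenrelr
  have hS55 : ((σ g₅ : GL (Fin 2) A) : Matrix (Fin 2) (Fin 2) A) ^ 5 = c₅ • 1 := by
    rw [← Units.val_pow_eq_pow_val, ← map_pow, hc₅]
  have hrelS : ((σ g₅ : GL (Fin 2) A) : Matrix (Fin 2) (Fin 2) A) * (σ s : GL (Fin 2) A) *
      (σ g₅ : GL (Fin 2) A) = cr • ((σ s : GL (Fin 2) A) : Matrix (Fin 2) (Fin 2) A) := by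
    have h := mul_mul_eq_of_rel hcenrel (a := σ s) (b := σ g₅)
      (by rw [map_mul, map_mul, map_mul, map_inv])
    have h2 := congrArg (fun x : GL (Fin 2) A => (x : Matrix (Fin 2) (Fin 2) A)) h
    simp only [Units.val_mul, hcr, Matrix.smul_mul, Matrix.one_mul] at h2
    exact h2
  have hrelR : ((r g₅ : GL (Fin 2) A) : Matrix (Fin 2) (Fin 2) A) * (r s : GL (Fin 2) A) *
      (r g₅ : GL (Fin 2) A) = cr' • ((r s : GL (Fin 2) A) : Matrix (Fin 2) (Fin 2) A) := by
    have h := mul_mul_eq_of_rel hcenrelr (a := r s) (b := r g₅)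
      (by rw [map_mul, map_mul, map_mul, map_inv])
    have h2 := congrArg (fun x : GL (Fin 2) A => (x : Matrix (Fin 2) (Fin 2) A)) h
    simp only [Units.val_mul, hcr', Matrix.smul_mul, Matrix.one_mul] at h2
    exact h2
  /- (3) finite order and eigenvalues of `σ g₅` -/
  have hfo : IsOfFinOrder (σ g₅) :=
    σ.range.subtype.isOfFinOrder (isOfFinOrder_of_finite (⟨σ g₅, g₅, rfl⟩ : σ.range))
  obtain ⟨m, hm, hgm⟩ := hfo.exists_pow_eq_one
  have hS5m : ((σ g₅ : GL (Fin 2) A) : Matrix (Fin 2) (Fin 2) A) ^ m = 1 := by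
    rw [← Units.val_pow_eq_pow_val, hgm, Units.val_one]
  have hSns : ∀ cc : A, ((σ g₅ : GL (Fin 2) A) : Matrix (Fin 2) (Fin 2) A) ≠ cc • 1 :=
    fun cc hcc => hncen (mem_center_of_eq_smul_one hcc)
  obtain ⟨l₁, l₂, htr, hdet, h1, h2, hne, hsq⟩ := exists_eigenvalues hm hS5m hSns hS55
  /- (4) the normal frame for `σ` -/
  obtain ⟨U, b, hb, hUS5, hUSs⟩ := exists_normal_frame σ h1 h2 hne hsq htr hdet hrelS
  /- (5) the normal frame for `r` -/
  obtain ⟨ε₁, hε₁, htrR⟩ : ∃ ε : A, (ε = 1 ∨ ε = -1) ∧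
      ((r g₅ : GL (Fin 2) A) : Matrix (Fin 2) (Fin 2) A).trace = ε * l₁ + ε * l₂ := by
    rcases (hdt g₅).2 with h | h
    · exact ⟨1, Or.inl rfl, by rw [h, htr]; ring⟩
    · exact ⟨-1, Or.inr rfl, by rw [h, htr]; ring⟩
  have hεε : ε₁ * ε₁ = 1 := by rcases hε₁ with h | h <;> simp [h]
  have hε0 : ε₁ ≠ 0 := by rcases hε₁ with h | h <;> simp [h]
  have hdetR : ((r g₅ : GL (Fin 2) A) : Matrix (Fin 2) (Fin 2) A).det = ε₁ * l₁ * (ε₁ * l₂) := by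
    rw [(hdt g₅).1, hdet]; linear_combination -(l₁ * l₂) * hεε
  have hneR : ε₁ * l₁ ≠ ε₁ * l₂ := fun h => hne (mul_left_cancel₀ hε0 h)
  have h1R : ε₁ * l₁ ≠ 0 := mul_ne_zero hε0 h1
  have h2R : ε₁ * l₂ ≠ 0 := mul_ne_zero hε0 h2
  have hsqR : (ε₁ * l₁) ^ 2 ≠ (ε₁ * l₂) ^ 2 := by
    rw [mul_pow, mul_pow, sq ε₁, hεε, one_mul, one_mul]; exact hsq
  obtain ⟨U', b', -, hU'R5, hU'Rs⟩ := exists_normal_frame r h1R h2R hneR hsqR htrR hdetR hrelR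
  /- (6) the conjugated representations -/
  set σ₂ : Γ →* GL (Fin 2) A := (MulAut.conj U).toMonoidHom.comp σ with hσ₂
  set r₂ : Γ →* GL (Fin 2) A := (MulAut.conj U').toMonoidHom.comp r with hr₂
  have hσ₂5 : ((σ₂ g₅ : GL (Fin 2) A) : Matrix (Fin 2) (Fin 2) A) = !![l₁, 0; 0, l₂] := hUS5
  have hσ₂s : ((σ₂ s : GL (Fin 2) A) : Matrix (Fin 2) (Fin 2) A) = !![0, b; b, 0] := hUSs
  have hr₂5 : ((r₂ g₅ : GL (Fin 2) A) : Matrix (Fin 2) (Fin 2) A) = ε₁ • !![l₁, 0; 0, l₂] := by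
    change (((U' * r g₅ * U'⁻¹ : GL (Fin 2) A)) : Matrix (Fin 2) (Fin 2) A) = _
    rw [hU'R5]
    ext i j
    fin_cases i <;> fin_cases j <;> simp
  have hr₂s' : ((r₂ s : GL (Fin 2) A) : Matrix (Fin 2) (Fin 2) A) = !![0, b'; b', 0] := hU'Rs
  -- `b' = ± b` from `det r(s) = det σ(s)`
  have hbb : b' * b' = b * b := by
    have hds : ((σ₂ s : GL (Fin 2) A) : Matrix (Fin 2) (Fin 2) A).det =
        ((σ s : GL (Fin 2) A) : Matrix (Fin 2) (Fin 2) A).det := by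
      change ((U * σ s * U⁻¹ : GL (Fin 2) A) : Matrix (Fin 2) (Fin 2) A).det = _
      rw [Units.val_mul, Units.val_mul, Matrix.det_units_conj]
    have hdr : ((r₂ s : GL (Fin 2) A) : Matrix (Fin 2) (Fin 2) A).det =
        ((r s : GL (Fin 2) A) : Matrix (Fin 2) (Fin 2) A).det := by
      change ((U' * r s * U'⁻¹ : GL (Fin 2) A) : Matrix (Fin 2) (Fin 2) A).det = _
      rw [Units.val_mul, Units.val_mul, Matrix.det_units_conj]
    have h := (hdt s).1
    rw [← hds, ← hdr, hσ₂s, hr₂s', Matrix.det_fin_two_of, Matrix.det_fin_two_of] at h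
    linear_combination -h
  obtain ⟨ε₂, hε₂, hb'⟩ : ∃ ε : A, (ε = 1 ∨ ε = -1) ∧ b' = ε * b := by
    rcases mul_self_eq_mul_self_iff.mp hbb with h | h
    · exact ⟨1, Or.inl rfl, by rw [h, one_mul]⟩
    · exact ⟨-1, Or.inr rfl, by rw [h]; ring⟩
  have hr₂s : ((r₂ s : GL (Fin 2) A) : Matrix (Fin 2) (Fin 2) A) = ε₂ • !![0, b; b, 0] := by
    rw [hr₂s', hb']
    ext i j
    fin_cases i <;> fin_cases j <;> simp
  /- (7) the trace/determinant relations survive conjugation -/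
  have hdt₂ : ∀ g : Γ, Matrix.det ((r₂ g : GL (Fin 2) A) : Matrix (Fin 2) (Fin 2) A) =
      Matrix.det ((σ₂ g : GL (Fin 2) A) : Matrix (Fin 2) (Fin 2) A) ∧
      (Matrix.trace ((r₂ g : GL (Fin 2) A) : Matrix (Fin 2) (Fin 2) A) =
          Matrix.trace ((σ₂ g : GL (Fin 2) A) : Matrix (Fin 2) (Fin 2) A) ∨
       Matrix.trace ((r₂ g : GL (Fin 2) A) : Matrix (Fin 2) (Fin 2) A) =
          -Matrix.trace ((σ₂ g : GL (Fin 2) A) : Matrix (Fin 2) (Fin 2) A)) := by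
    intro g
    change Matrix.det ((U' * r g * U'⁻¹ : GL (Fin 2) A) : Matrix (Fin 2) (Fin 2) A) =
        Matrix.det ((U * σ g * U⁻¹ : GL (Fin 2) A) : Matrix (Fin 2) (Fin 2) A) ∧
      (Matrix.trace ((U' * r g * U'⁻¹ : GL (Fin 2) A) : Matrix (Fin 2) (Fin 2) A) =
          Matrix.trace ((U * σ g * U⁻¹ : GL (Fin 2) A) : Matrix (Fin 2) (Fin 2) A) ∨
       Matrix.trace ((U' * r g * U'⁻¹ : GL (Fin 2) A) : Matrix (Fin 2) (Fin 2) A) =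
          -Matrix.trace ((U * σ g * U⁻¹ : GL (Fin 2) A) : Matrix (Fin 2) (Fin 2) A))
    simp only [Units.val_mul, Matrix.det_units_conj, Matrix.trace_units_conj]
    exact hdt g
  /- (8) E4 + E5 in the normal form, and conjugating back -/
  obtain ⟨χ, M₀, hχ, hM⟩ :=
    exists_twist_of_normal_form σ₂ r₂ hdt₂ h1 h2 hne hsq hb hε₁ hε₂ hσ₂5 hσ₂s hr₂5 hr₂s
  refine ⟨χ, U'⁻¹ * M₀ * U, hχ, fun g => ?_⟩
  have e1 : (r g : GL (Fin 2) A) = U'⁻¹ * r₂ g * U' := by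
    change r g = U'⁻¹ * (U' * r g * U'⁻¹) * U'
    group
  have e2 : (U'⁻¹ * M₀ * U * σ g * (U'⁻¹ * M₀ * U)⁻¹ : GL (Fin 2) A) =
      U'⁻¹ * (M₀ * σ₂ g * M₀⁻¹) * U' := by
    change _ = U'⁻¹ * (M₀ * (U * σ g * U⁻¹) * M₀⁻¹) * U'
    group
  have e3 : ((r g : GL (Fin 2) A) : Matrix (Fin 2) (Fin 2) A) =
      ((U'⁻¹ : GL (Fin 2) A) : Matrix (Fin 2) (Fin 2) A) * (r₂ g : GL (Fin 2) A) * U' := by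
    rw [← Units.val_mul, ← Units.val_mul, ← e1]
  rw [e3, hM g, Matrix.mul_smul, Matrix.smul_mul, ← Units.val_mul, ← Units.val_mul, ← e2]

end Summit.Langlands.Langlands.Theorems.ArtinWeightRealisationEven
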